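import Summits.Ventures.Crystal3D.Theorems.StickyWulffConstantStackingLiminfMollifierSmooth
import HarnessLib

/-!
# Stub (D) `stub_mollifierRegularity` of line `LayerChain` v4 (crux `StackingLiminf`, stmt-Ventures-19145),
# part 2/2: the layer profile, the window density, and the stub BY NAME

Cell `crystal3d-full`, venture `Summits/Ventures/Crystal3D`.  Registered stub (D) of the planner's line
LayerChain v4 (`HOME/cf-p1/route/lines/LayerChainV4.lean`, cf-p1 gen 13; vocabulary
`…StackingLiminfLayerChainV4Defs.lean`).  Part 1 (`…MollifierSmooth.lean`) proved that `smooth x K L` is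
`C²`, compactly supported and nonnegative.  Here:

* `layerProf K` (the lateral integral of the bump at height `ζ`) is continuous (parametric integral of a
  continuous integrand over the compact ball, `continuous_parametric_integral_of_continuous`), vanishes
  for `|ζ| ≥ K` and is positive for `|ζ| < K`;
* the window density `window σ K` is continuous with values in `[0,1]`: its two `finsum`s are locally
  finite sums of translates `t ↦ layerProf K (t − k h)` (`continuous_finsum`), and the denominator is
  positive because every height is within `h/2 < 1 ≤ K` of a layer (`finsum_layerProf_pos`).

Main theorem: `stub_mollifierRegularity : MollifierRegularity` (BY NAME, def-free over the landed V4Defs).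
WHAT THIS IS NOT: any inequality of the line; routine analysis only.
-/

noncomputable section

namespace Summit.Ventures.Crystal3D.Theorems

open MeasureTheory Set Filter Function
open Summit.Ventures.Crystal3D.LayerChain (dot3)
open Summit.Ventures.Crystal3D.Cruxes.StackingLiminf.LayerChainV4
open scoped Topology

/-! ### The layer profile `layerProf K` -/

/-- The embedding `z ↦ (z.1, z.2, ζ)` of the lateral plane at height `ζ` is continuous. -/
theorem continuous_vec_of_plane (ζ : ℝ) :
    Continuous fun z : ℝ × ℝ => (![z.1, z.2, ζ] : Fin 3 → ℝ) :=
  continuous_pi fun j => by fin_cases j <;> simp <;> fun_prop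

/-- Joint continuity of the integrand of `layerProf` in (height, lateral point). -/
theorem layerProf_integrand_continuous (K : ℝ) :
    Continuous (Function.uncurry fun (ζ : ℝ) (z : ℝ × ℝ) => bump K (![z.1, z.2, ζ] : Fin 3 → ℝ)) :=
  (continuous_bump K).comp (continuous_pi fun j => by fin_cases j <;> simp <;> fun_prop)

/-- The integrand of `layerProf` vanishes outside the lateral sup-norm ball of radius `K`. -/
theorem layerProf_integrand_eq_zero {K : ℝ} (hK : 0 < K) (ζ : ℝ) (z : ℝ × ℝ)
    (hz : z ∉ Metric.closedBall (0 : ℝ × ℝ) K) : bump K (![z.1, z.2, ζ] : Fin 3 → ℝ) = 0 := by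
  rw [Metric.mem_closedBall, dist_zero_right, Prod.norm_def, max_le_iff, not_and_or,
    Real.norm_eq_abs, Real.norm_eq_abs, not_le, not_le] at hz
  rcases hz with h | h
  · exact bump_eq_zero_of_coord hK 0 (by simpa using h.le)
  · exact bump_eq_zero_of_coord hK 1 (by simpa using h.le)

/-- `layerProf` as an integral over the compact lateral ball of radius `K`. -/
theorem layerProf_eq_setIntegral {K : ℝ} (hK : 0 < K) (ζ : ℝ) :
    layerProf K ζ = ∫ z in Metric.closedBall (0 : ℝ × ℝ) K, bump K (![z.1, z.2, ζ] : Fin 3 → ℝ) := by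
  unfold layerProf
  exact (setIntegral_eq_integral_of_forall_compl_eq_zero fun z hz =>
    layerProf_integrand_eq_zero hK ζ z hz).symm

/-- The layer profile is continuous in the height. -/
theorem continuous_layerProf {K : ℝ} (hK : 0 < K) : Continuous (layerProf K) := by
  have h : layerProf K = fun ζ => ∫ z in Metric.closedBall (0 : ℝ × ℝ) K,
      bump K (![z.1, z.2, ζ] : Fin 3 → ℝ) := funext (layerProf_eq_setIntegral hK)
  rw [h]
  exact continuous_parametric_integral_of_continuous (layerProf_integrand_continuous K)
    (isCompact_closedBall _ _)

/-- The layer profile is nonnegative. -/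
theorem layerProf_nonneg {K : ℝ} (hK : 0 < K) (ζ : ℝ) : 0 ≤ layerProf K ζ :=
  integral_nonneg fun _ => bump_nonneg hK _

/-- The layer profile vanishes at heights `|ζ| ≥ K`. -/
theorem layerProf_eq_zero {K : ℝ} (hK : 0 < K) {ζ : ℝ} (hζ : K ≤ |ζ|) : layerProf K ζ = 0 := by
  unfold layerProf
  have : (fun z : ℝ × ℝ => bump K (![z.1, z.2, ζ] : Fin 3 → ℝ)) = fun _ => 0 := by
    funext z; exact bump_eq_zero_of_coord hK 2 (by simpa using hζ)
  rw [this, integral_zero]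

/-- The layer profile is positive at heights `|ζ| < K`. -/
theorem layerProf_pos {K : ℝ} (hK : 0 < K) {ζ : ℝ} (hζ : |ζ| < K) : 0 < layerProf K ζ := by
  unfold layerProf
  have hcont : Continuous fun z : ℝ × ℝ => bump K (![z.1, z.2, ζ] : Fin 3 → ℝ) :=
    (continuous_bump K).comp (continuous_vec_of_plane ζ)
  have hsupp : HasCompactSupport fun z : ℝ × ℝ => bump K (![z.1, z.2, ζ] : Fin 3 → ℝ) :=
    HasCompactSupport.intro (isCompact_closedBall (0 : ℝ × ℝ) K) fun z hz =>
      layerProf_integrand_eq_zero hK ζ z hz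
  refine integral_pos_of_integrable_nonneg_nonzero (x := ((0 : ℝ), (0 : ℝ))) hcont
    (hcont.integrable_of_hasCompactSupport hsupp) (fun z => bump_nonneg hK _) (bump_pos hK ?_).ne'
  have h1 := abs_lt.1 hζ
  unfold dot3
  simp
  nlinarith [h1.1, h1.2]

/-! ### (D4)/(D5) the window density -/

/-- The layer spacing `h = √(2/3)` is positive. -/
theorem hLayer_pos : 0 < Real.sqrt (2 / 3) := Real.sqrt_pos.2 (by norm_num)

/-- The layer spacing `h = √(2/3)` is less than `1`. -/
theorem hLayer_lt_one : Real.sqrt (2 / 3) < 1 := by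
  rw [show (1 : ℝ) = Real.sqrt 1 by simp]
  exact Real.sqrt_lt_sqrt (by norm_num) (by norm_num)

/-- Only finitely many layers are within distance `r` of a given height. -/
theorem finite_layers (t r : ℝ) : {k : ℤ | |t - k * Real.sqrt (2 / 3)| < r}.Finite := by
  refine (Set.finite_Icc ⌈(t - r) / Real.sqrt (2 / 3)⌉ ⌊(t + r) / Real.sqrt (2 / 3)⌋).subset
    fun k hk => ?_
  simp only [Set.mem_setOf_eq, abs_lt] at hk
  simp only [Set.mem_Icc]
  constructor
  · refine Int.ceil_le.2 ?_
    rw [div_le_iff₀ hLayer_pos]; linarith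
  · refine Int.le_floor.2 ?_
    rw [le_div_iff₀ hLayer_pos]; linarith

/-- At a fixed height only finitely many layer profiles are nonzero. -/
theorem support_layerProf_translates_finite {K : ℝ} (hK : 0 < K) (t : ℝ) :
    (support fun k : ℤ => layerProf K (t - k * Real.sqrt (2 / 3))).Finite :=
  (finite_layers t K).subset fun k hk => by
    by_contra h
    exact hk (layerProf_eq_zero hK (not_lt.1 h))

/-- The family of supports of the translated layer profiles is locally finite. -/
theorem locallyFinite_layerProf_translates {K : ℝ} (hK : 0 < K) :
    LocallyFinite fun k : ℤ => support fun t : ℝ => layerProf K (t - k * Real.sqrt (2 / 3)) := by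
  intro t
  refine ⟨Ioo (t - 1) (t + 1), Ioo_mem_nhds (by linarith) (by linarith), ?_⟩
  refine (finite_layers t (K + 1)).subset fun k hk => ?_
  obtain ⟨t', ht'supp, ht'U⟩ := hk
  rw [mem_support] at ht'supp
  have h1 : |t' - k * Real.sqrt (2 / 3)| < K := by
    by_contra h
    exact ht'supp (layerProf_eq_zero hK (not_lt.1 h))
  simp only [Set.mem_setOf_eq]
  rw [Set.mem_Ioo] at ht'U
  have := abs_lt.1 h1
  rw [abs_lt]
  constructor <;> linarith [this.1, this.2, ht'U.1, ht'U.2]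

/-- The denominator of the window density is continuous. -/
theorem continuous_finsum_layerProf {K : ℝ} (hK : 0 < K) :
    Continuous fun t : ℝ => ∑ᶠ k : ℤ, layerProf K (t - k * Real.sqrt (2 / 3)) :=
  continuous_finsum (fun _ => (continuous_layerProf hK).comp (continuous_id.sub continuous_const))
    (locallyFinite_layerProf_translates hK)

/-- The numerator of the window density is continuous. -/
theorem continuous_finsum_layerProf_ite (σ : ℤ → ℤ) {K : ℝ} (hK : 0 < K) :
    Continuous fun t : ℝ =>
      ∑ᶠ k : ℤ, if σ k = -1 then layerProf K (t - k * Real.sqrt (2 / 3)) else 0 := by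
  refine continuous_finsum (fun k => ?_) ((locallyFinite_layerProf_translates hK).subset fun k => ?_)
  · by_cases h : σ k = -1
    · simp only [h, if_true]
      exact (continuous_layerProf hK).comp (continuous_id.sub continuous_const)
    · simp only [h, if_false]
      exact continuous_const
  · intro t ht
    rw [mem_support] at ht ⊢
    by_cases h : σ k = -1
    · simpa [h] using ht
    · simp [h] at ht

/-- The denominator of the window density is positive: every height is within `h/2 < 1 ≤ K` of a layer. -/
theorem finsum_layerProf_pos {K : ℝ} (hK : 1 ≤ K) (t : ℝ) :
    0 < ∑ᶠ k : ℤ, layerProf K (t - k * Real.sqrt (2 / 3)) := by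
  have hK0 : 0 < K := by linarith
  set k₀ : ℤ := round (t / Real.sqrt (2 / 3)) with hk₀
  have hclose : |t - k₀ * Real.sqrt (2 / 3)| < K := by
    have h1 : |t / Real.sqrt (2 / 3) - k₀| ≤ 1 / 2 := by rw [hk₀]; exact abs_sub_round _
    have h2 : t - k₀ * Real.sqrt (2 / 3) = (t / Real.sqrt (2 / 3) - k₀) * Real.sqrt (2 / 3) := by
      field_simp
    rw [h2, abs_mul, abs_of_pos hLayer_pos]
    calc |t / Real.sqrt (2 / 3) - k₀| * Real.sqrt (2 / 3) ≤ 1 / 2 * 1 :=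
          mul_le_mul h1 hLayer_lt_one.le hLayer_pos.le (by norm_num)
      _ < K := by linarith
  have hpos : 0 < layerProf K (t - k₀ * Real.sqrt (2 / 3)) := layerProf_pos hK0 hclose
  have hfin := support_layerProf_translates_finite hK0 t
  rw [finsum_eq_sum_of_support_subset _ (s := hfin.toFinset) (by rw [Set.Finite.coe_toFinset])]
  refine lt_of_lt_of_le hpos (Finset.single_le_sum
    (f := fun k : ℤ => layerProf K (t - k * Real.sqrt (2 / 3))) (fun k _ => layerProf_nonneg hK0 _) ?_)
  rw [Set.Finite.mem_toFinset, mem_support]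
  exact hpos.ne'

/-- (D4) The window density is continuous (for `K ≥ 1`). -/
theorem continuous_window (σ : ℤ → ℤ) {K : ℝ} (hK : 1 ≤ K) : Continuous (window σ K) := by
  have hK0 : 0 < K := by linarith
  show Continuous fun t => window σ K t
  unfold window
  exact (continuous_finsum_layerProf_ite σ hK0).div (continuous_finsum_layerProf hK0)
    fun t => (finsum_layerProf_pos hK t).ne'

/-- (D5) The window density takes values in `[0,1]` (for `K ≥ 1`). -/
theorem window_mem_Icc (σ : ℤ → ℤ) {K : ℝ} (hK : 1 ≤ K) (t : ℝ) :
    0 ≤ window σ K t ∧ window σ K t ≤ 1 := by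
  have hK0 : 0 < K := by linarith
  have hden := finsum_layerProf_pos hK t
  have hterm : ∀ k : ℤ, 0 ≤ (if σ k = -1 then layerProf K (t - k * Real.sqrt (2 / 3)) else 0) ∧
      (if σ k = -1 then layerProf K (t - k * Real.sqrt (2 / 3)) else 0) ≤
        layerProf K (t - k * Real.sqrt (2 / 3)) := by
    intro k
    by_cases h : σ k = -1
    · simp only [h, if_true]
      exact ⟨layerProf_nonneg hK0 _, le_rfl⟩
    · simp only [h, if_false]
      exact ⟨le_rfl, layerProf_nonneg hK0 _⟩
  have hnum : 0 ≤ ∑ᶠ k : ℤ, (if σ k = -1 then layerProf K (t - k * Real.sqrt (2 / 3)) else 0) :=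
    finsum_nonneg fun k => (hterm k).1
  have hfin := support_layerProf_translates_finite hK0 t
  have hfin' : (support fun k : ℤ =>
      if σ k = -1 then layerProf K (t - k * Real.sqrt (2 / 3)) else 0).Finite :=
    hfin.subset fun k hk => by
      rw [mem_support] at hk ⊢
      by_cases h : σ k = -1
      · simpa [h] using hk
      · simp [h] at hk
  have hle : ∑ᶠ k : ℤ, (if σ k = -1 then layerProf K (t - k * Real.sqrt (2 / 3)) else 0) ≤
      ∑ᶠ k : ℤ, layerProf K (t - k * Real.sqrt (2 / 3)) :=
    finsum_le_finsum' hfin' hfin fun k => (hterm k).2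
  unfold window
  exact ⟨div_nonneg hnum hden.le, div_le_one_of_le₀ hle hden.le⟩

/-! ### The stub -/

/-- **Stub (D) of LayerChain v4, BY NAME**: regularity of the explicit mollifiers. -/
theorem stub_mollifierRegularity : MollifierRegularity := by
  intro N σ _hσ x K L hK hKL
  have hK0 : 0 < K := lt_of_lt_of_le one_pos hK
  have hL0 : 0 < L := lt_of_lt_of_le hK0 hKL
  exact ⟨contDiff_smooth x L hK0, hasCompactSupport_smooth x hK0 hL0, smooth_nonneg x hK0 L,
    continuous_window σ hK, window_mem_Icc σ hK⟩

end Summit.Ventures.Crystal3D.Theorems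

end
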